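import Summits.CriticalPhenomena.PercolationContinuityZ3.Theorems.PercNearOneGluingNoHeavyLowerTailThreePartitionCubeCheckPacked
import Summits.CriticalPhenomena.PercolationContinuityZ3.Theorems.PercNearOneGluingNoHeavyLowerTailThreePartitionCubeProfile
import Summits.CriticalPhenomena.PercolationContinuityZ3.Theorems.PercNearOneGluingNoHeavyLowerTailSahiPair43LinkGreedy
import Summits.CriticalPhenomena.PercolationContinuityZ3.Theorems.PercNearOneGluingNoHeavyLowerTailSahiHittingBoxMemoPrelim

/-!
# Twisted three-partition positivity (★★) = (M⁺-3) on SIX letters: soundness of the checker, X — **the coordinate keys as statistics**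

Support file (cell `prim-sahi`, seat `prim-sahi-typer` gen 34; `--supports stmt-CriticalPhenomena-4575`).  Pure, plus the statistic definitions
(`gS`, `gQ`, `statS`, `statF`, `statD`, `statTri`); no `sorry`, standard axioms.
The checker's symmetry reduction expands a node only if its coordinate keys are sorted (`keySorted`) and, within ties, the colouring's class-key
products are sorted (`tieOk`).  Here the keys are identified with ORDER-INDEPENDENT statistics of the code set, so that (next file) they are covariant
under coordinate permutations and a sorting permutation exists:
* `keysOf_getD` — component `i` of the running first-order keys of a list `Q` is `statS m Q.toFinset i = Σ_{x∈Q} [xᵢ] 16^{|x|}`;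
* `fullKey_getD` — component `i` of `fullKey` is `statS · C40 + statTri`, where `statTri Q i = Σ_{j<k} gQ i Q[j] Q[k]` and
  **`two_mul_statTri_add_statD`**: `2·statTri + statD = statF` (full double sum), so `statTri` depends on `Q.toFinset` only (`statTri_eq_of_toFinset_eq`);
* `classKey_eq` — the class keys are position sums of `gS`; `keySorted_iff`, `tieOk_iff`. [this work]
-/

namespace Summit.CriticalPhenomena.PercolationContinuityZ3.Theorems.ThreePartition.Cube

open Finset SahiGridPattern.Pair43 SahiC3Cube
open scoped Classical

variable {m : ℕ}

/-! ### Node data: running keys, the zero key array; counting -/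

/-- The keys of a node reached by appending the points of `Q` one by one. [this work] -/
def keysOf (T : Tabs) (S : Array ℕ) (Q : List ℕ) : Array ℕ := Q.foldl (sAdd T) S

/-- The all-zero key array. [this work] -/
def zeros (T : Tabs) : Array ℕ := Array.replicate T.m 0

/-- `countBelow` is the cardinality of a filter of `range`. [this work] -/
theorem countBelow_eq_card (n : ℕ) (p : ℕ → Bool) : countBelow n p = ((range n).filter fun j => p j = true).card := by
  induction n with
  | zero => simp [countBelow]
  | succ n ih =>
    rw [countBelow, ih, range_add_one, filter_insert]
    split_ifs with h
    · rw [card_insert_of_notMem (by simp)]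
    · simp

/-- `pc` is the number of set bits below `n`. [this work] -/
theorem pc_eq_card (n x : ℕ) : pc n x = ((range n).filter fun i => x.testBit i = true).card := countBelow_eq_card n _

/-! ### The statistics -/

/-- First-order term of the code `x` at coordinate `i`: `[xᵢ]·16^{|x|}`. [this work] -/
def gS (m i x : ℕ) : ℕ := if x.testBit i then w16 (pc m x) else 0

/-- Second-order term of the pair of codes `(x, x')` at coordinate `i`: `[(x ∧ x')ᵢ]·16^{|x∧x'|}·(3+|x|+|x'|)` (symmetric). [this work] -/
def gQ (m i x x' : ℕ) : ℕ := if (x &&& x').testBit i then w16 (pc m (x &&& x')) * (3 + pc m x + pc m x') else 0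

/-- `gQ` is symmetric. [this work] -/
theorem gQ_comm (m i x x' : ℕ) : gQ m i x x' = gQ m i x' x := by
  unfold gQ; rw [Nat.land_comm]; simp only [Nat.add_right_comm]

/-- `statS P i = Σ_{x∈P} gS i x`. [this work] -/
def statS (m : ℕ) (P : Finset ℕ) (i : ℕ) : ℕ := ∑ x ∈ P, gS m i x

/-- Full double sum `Σ_{x,x'∈P} gQ i x x'`. [this work] -/
def statF (m : ℕ) (P : Finset ℕ) (i : ℕ) : ℕ := ∑ x ∈ P, ∑ x' ∈ P, gQ m i x x'

/-- Diagonal sum `Σ_{x∈P} gQ i x x`. [this work] -/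
def statD (m : ℕ) (P : Finset ℕ) (i : ℕ) : ℕ := ∑ x ∈ P, gQ m i x x

/-- Triangular (position) sum `Σ_{k<n} Σ_{j<k} gQ i Q[j] Q[k]` of a list. [this work] -/
def statTri (m : ℕ) (Q : List ℕ) (i : ℕ) : ℕ := ∑ k ∈ range Q.length, ∑ j ∈ range k, gQ m i (Q.getD j 0) (Q.getD k 0)

/-! ### Sums over positions of a list -/

/-- A sum over the positions of a list is the sum of the mapped list. [this work] -/
theorem sum_range_getD (Q : List ℕ) (f : ℕ → ℕ) : ∑ k ∈ range Q.length, f (Q.getD k 0) = (Q.map f).sum := by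
  induction Q with
  | nil => simp
  | cons a Q ih =>
    rw [List.length_cons, sum_range_succ', List.map_cons, List.sum_cons]
    simp only [List.getD_cons_succ, List.getD_cons_zero]
    rw [ih, add_comm]

/-- For a duplicate-free list, a sum over positions is a sum over the underlying finset. [this work] -/
theorem sum_range_getD_eq_sum_toFinset {Q : List ℕ} (hQ : Q.Nodup) (f : ℕ → ℕ) :
    ∑ k ∈ range Q.length, f (Q.getD k 0) = ∑ x ∈ Q.toFinset, f x := by
  rw [sum_range_getD, List.sum_toFinset _ hQ]

/-- **`2·statTri + diagonal = full double sum`** on positions (symmetry of `gQ`). [this work] -/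
theorem two_mul_statTri_add_diag (m i : ℕ) (Q : List ℕ) :
    2 * statTri m Q i + ∑ k ∈ range Q.length, gQ m i (Q.getD k 0) (Q.getD k 0) =
      ∑ k ∈ range Q.length, ∑ j ∈ range Q.length, gQ m i (Q.getD j 0) (Q.getD k 0) := by
  unfold statTri
  generalize Q.length = n
  induction n with
  | zero => simp
  | succ n ih =>
    rw [sum_range_succ, sum_range_succ, sum_range_succ (fun k => ∑ j ∈ range (n + 1), gQ m i (Q.getD j 0) (Q.getD k 0)), sum_range_succ]
    have hsplit : ∑ k ∈ range n, ∑ j ∈ range (n + 1), gQ m i (Q.getD j 0) (Q.getD k 0) =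
        ∑ k ∈ range n, ∑ j ∈ range n, gQ m i (Q.getD j 0) (Q.getD k 0) + ∑ k ∈ range n, gQ m i (Q.getD n 0) (Q.getD k 0) := by
      rw [← sum_add_distrib]; exact sum_congr rfl fun k _ => sum_range_succ _ _
    have hsym : ∑ k ∈ range n, gQ m i (Q.getD n 0) (Q.getD k 0) = ∑ j ∈ range n, gQ m i (Q.getD j 0) (Q.getD n 0) :=
      sum_congr rfl fun k _ => gQ_comm _ _ _ _
    rw [hsplit, hsym, ← ih]
    ring

/-- `statTri` as finset statistics for a duplicate-free list: `2·statTri + statD = statF`. [this work] -/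
theorem two_mul_statTri_add_statD {Q : List ℕ} (hQ : Q.Nodup) (m i : ℕ) :
    2 * statTri m Q i + statD m Q.toFinset i = statF m Q.toFinset i := by
  unfold statD statF
  rw [← sum_range_getD_eq_sum_toFinset hQ, two_mul_statTri_add_diag,
    sum_range_getD_eq_sum_toFinset hQ (fun y => ∑ j ∈ range Q.length, gQ m i (Q.getD j 0) y)]
  exact sum_congr rfl fun x _ =>
    (sum_range_getD_eq_sum_toFinset hQ (fun z => gQ m i z x)).trans (sum_congr rfl fun z _ => gQ_comm _ _ _ _)

/-- Hence `statTri` depends on the underlying finset only. [this work] -/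
theorem statTri_eq_of_toFinset_eq {Q Q' : List ℕ} (hQ : Q.Nodup) (hQ' : Q'.Nodup) (h : Q.toFinset = Q'.toFinset) (m i : ℕ) :
    statTri m Q i = statTri m Q' i := by
  have h1 := two_mul_statTri_add_statD hQ m i
  have h2 := two_mul_statTri_add_statD hQ' m i
  rw [h] at h1
  omega

/-! ### Folds as sums -/

/-- A conditional accumulating fold is the initial value plus a sum. [this work] -/
theorem foldBelow_ite_add (n : ℕ) (c : ℕ → Bool) (t : ℕ → ℕ) (a : ℕ) :
    foldBelow n (fun j acc => if c j then acc + t j else acc) a = a + ∑ j ∈ range n, (if c j then t j else 0) := by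
  induction n with
  | zero => simp [foldBelow]
  | succ n ih =>
    rw [foldBelow, ih, sum_range_succ]
    by_cases h : c n = true
    · rw [if_pos h, if_pos h, add_assoc]
    · rw [if_neg h, if_neg h, add_zero]

/-- A conditional accumulating `List.foldl` is the initial value plus the sum of the mapped list. [this work] -/
theorem list_foldl_ite_add (Q : List ℕ) (c : ℕ → Bool) (t : ℕ → ℕ) (a : ℕ) :
    Q.foldl (fun acc x => if c x then acc + t x else acc) a = a + (Q.map fun x => if c x then t x else 0).sum := by
  induction Q generalizing a with
  | nil => simp
  | cons x Q ih =>
    rw [List.foldl_cons, ih, List.map_cons, List.sum_cons]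
    by_cases h : c x = true
    · rw [if_pos h, if_pos h, add_assoc]
    · rw [if_neg h, if_neg h, zero_add]

/-! ### The keys -/

/-- All codes of the list are below `2^m`. [this work] -/
def CodesLt (m : ℕ) (Q : List ℕ) : Prop := ∀ x ∈ Q, x < 2 ^ m

/-- `(mkTabs m).m = m`. [this work] -/
theorem mkTabs_m (m : ℕ) : (mkTabs m).m = m := rfl

/-- Entries of a `CodesLt` list are below `2^m` (positions in range). [this work] -/
theorem CodesLt.getD_lt {Q : List ℕ} (hQ : CodesLt m Q) {j : ℕ} (hj : j < Q.length) : Q.getD j 0 < 2 ^ m := by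
  rw [List.getD_eq_getElem (l := Q) (d := 0) hj]; exact hQ _ (List.getElem_mem hj)

/-- **The running first-order keys are `statS`**: component `i < m` of `keysOf (mkTabs m) S Q` is `S_i + Σ_{x∈Q} gS i x`. [this work] -/
theorem keysOf_getD (S : Array ℕ) {Q : List ℕ} (hQ : CodesLt m Q) {i : ℕ} (hi : i < m) :
    (keysOf (mkTabs m) S Q).getD i 0 = S.getD i 0 + (Q.map (gS m i)).sum := by
  induction Q generalizing S with
  | nil => simp [keysOf]
  | cons x Q ih =>
    have hx : x < 2 ^ m := hQ x (by simp)
    have hQ' : CodesLt m Q := fun y hy => hQ y (by simp [hy])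
    show (keysOf (mkTabs m) (sAdd (mkTabs m) S x) Q).getD i 0 = _
    rw [ih (sAdd (mkTabs m) S x) hQ', List.map_cons, List.sum_cons, ← add_assoc]
    congr 1
    unfold sAdd
    rw [getD_ofFn _ _ (show i < (mkTabs m).m from hi)]
    simp only [mkTabs_pcT_getD m x hx, gS]

/-- The running keys from zero, as the statistic of the underlying finset (duplicate-free list). [this work] -/
theorem keysOf_zeros_getD {Q : List ℕ} (hQ : CodesLt m Q) (hnd : Q.Nodup) {i : ℕ} (hi : i < m) :
    (keysOf (mkTabs m) (zeros (mkTabs m)) Q).getD i 0 = statS m Q.toFinset i := by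
  rw [keysOf_getD _ hQ hi, statS, List.sum_toFinset _ hnd]
  unfold zeros
  rw [Array.getD_eq_getD_getElem?, Array.getElem?_replicate]
  simp [mkTabs_m, hi]

/-- **The full keys are `statS·C40 + statTri`.** [this work] -/
theorem fullKey_getD {Q : List ℕ} (hQ : CodesLt m Q) {i : ℕ} (hi : i < m) :
    (fullKey (mkTabs m) Q.toArray).getD i 0 = (Q.map (gS m i)).sum * C40 + statTri m Q i := by
  unfold fullKey
  rw [getD_ofFn _ _ (show i < (mkTabs m).m from hi)]
  dsimp only
  rw [List.foldl_toArray, List.size_toArray]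
  refine congrArg₂ (fun a b => a * C40 + b) ?_ ?_
  · -- the first-order part
    rw [list_foldl_ite_add, zero_add]
    refine congrArg List.sum (List.map_congr_left fun x hx => ?_)
    simp only [mkTabs_pcT_getD m x (hQ x hx), gS]
  · -- the second-order part
    have hinner : ∀ k acc, foldBelow k (fun j acc2 =>
        if ((Q.toArray.getD j 0) &&& (Q.toArray.getD k 0)).testBit i then
          acc2 + w16 ((mkTabs m).pcT.getD ((Q.toArray.getD j 0) &&& (Q.toArray.getD k 0)) 0) *
            (3 + (mkTabs m).pcT.getD (Q.toArray.getD j 0) 0 + (mkTabs m).pcT.getD (Q.toArray.getD k 0) 0)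
        else acc2) acc = acc + ∑ j ∈ range k, (if ((Q.toArray.getD j 0) &&& (Q.toArray.getD k 0)).testBit i then
          w16 ((mkTabs m).pcT.getD ((Q.toArray.getD j 0) &&& (Q.toArray.getD k 0)) 0) *
            (3 + (mkTabs m).pcT.getD (Q.toArray.getD j 0) 0 + (mkTabs m).pcT.getD (Q.toArray.getD k 0) 0) else 0) :=
      fun k acc => foldBelow_ite_add k _ _ acc
    simp only [hinner]
    rw [foldBelow_add_eq_sum]
    unfold statTri
    refine sum_congr rfl fun k hk => sum_congr rfl fun j hj => ?_
    rw [SahiHitting.array_getD_eq, SahiHitting.array_getD_eq]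
    have hk' : k < Q.length := mem_range.1 hk
    have hj' : j < Q.length := (mem_range.1 hj).trans hk'
    have hxk : Q.getD k 0 < 2 ^ m := hQ.getD_lt hk'
    have hxj : Q.getD j 0 < 2 ^ m := hQ.getD_lt hj'
    have hand : Q.getD j 0 &&& Q.getD k 0 < 2 ^ m := lt_of_le_of_lt Nat.and_le_left hxj
    simp only [mkTabs_pcT_getD m _ hxk, mkTabs_pcT_getD m _ hxj, mkTabs_pcT_getD m _ hand, gQ]

/-- The full keys as finset statistics (duplicate-free list). [this work] -/
theorem fullKey_getD' {Q : List ℕ} (hQ : CodesLt m Q) (hnd : Q.Nodup) {i : ℕ} (hi : i < m) :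
    (fullKey (mkTabs m) Q.toArray).getD i 0 = statS m Q.toFinset i * C40 + statTri m Q i := by
  rw [fullKey_getD hQ hi, statS, List.sum_toFinset _ hnd]

/-- **The class keys are position sums of `gS` over the class.** [this work] -/
theorem classKey_eq {Q : List ℕ} (hQ : CodesLt m Q) (mm : ℕ) (first : Bool) (i : ℕ) :
    classKey (mkTabs m) Q.toArray mm first i =
      ∑ j ∈ range Q.length, (if (inFirst mm j == first) then gS m i (Q.getD j 0) else 0) := by
  unfold classKey
  simp only [List.size_toArray]
  rw [foldBelow_ite_add, zero_add]
  refine sum_congr rfl fun j hj => ?_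
  rw [SahiHitting.array_getD_eq]
  have hx : Q.getD j 0 < 2 ^ m := hQ.getD_lt (mem_range.1 hj)
  simp only [mkTabs_pcT_getD m _ hx, gS]
  by_cases h1 : (inFirst mm j == first) = true <;> simp [h1]

/-- `keySorted` unfolded. [this work] -/
theorem keySorted_iff (K : Array ℕ) : keySorted (mkTabs m) K = true ↔ ∀ i < m - 1, K.getD i 0 ≤ K.getD (i + 1) 0 := by
  unfold keySorted
  rw [allBelow_iff, mkTabs_m]
  simp only [decide_eq_true_eq]

/-- `tieOk` unfolded. [this work] -/
theorem tieOk_iff (pts K : Array ℕ) (mm : ℕ) :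
    tieOk (mkTabs m) pts K mm = true ↔ ∀ i < m - 1, K.getD i 0 = K.getD (i + 1) 0 →
      classKey (mkTabs m) pts mm true i * classKey (mkTabs m) pts mm false i ≤
        classKey (mkTabs m) pts mm true (i + 1) * classKey (mkTabs m) pts mm false (i + 1) := by
  unfold tieOk
  rw [allBelow_iff, mkTabs_m]
  refine forall_congr' fun i => forall_congr' fun _ => ?_
  simp only [Bool.or_eq_true, Bool.not_eq_true', beq_eq_false_iff_ne, ne_eq, decide_eq_true_eq]
  tauto

end Summit.CriticalPhenomena.PercolationContinuityZ3.Theorems.ThreePartition.Cube
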